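import Summits.BirchSwinnertonDyer.BirchSwinnertonDyer.Theorems.EdixhovenFibreFiveSevenStarredOptimalManinUnitFiveSevenValueExit
import Summits.BirchSwinnertonDyer.BirchSwinnertonDyer.Theorems.InertBadSignedBranchesInertBadAtThreeOddPrimeInstances
import HarnessLib

/-!
# The VALUE EXIT of `stub_neronIntegralThreeQuartic`: the stub's `(ϖ, r)`-clauses follow from the Néron
# `3`-integrality of the twisted critical values `τ(χ)·L(V, χ̄, 1)/Ω^±(V)` — `f`-free, modular-symbol-free

Summit `BirchSwinnertonDyer`, crux `InertBadAtThree` (stmt-BirchSwinnertonDyer-19225; K8 `InertBadSignedBranches` r4 / BED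
`BiquadraticEisensteinDescent` r5), line of record `Cruxes/InertBadAtThree/Lines/rubin_e1_inert_three.lean` v4 (lead
`bsd-line-ibd-p1` g6), registered stub `stub_neronIntegralThreeQuartic` (= the body of the named Literature statement F-es-18
`kato_neron_isIntegral_twistedSymbolSum_of_additive_three_polar` for ONE globally minimal `V` with `j(V) = 1728` bad at `3`).
Width seat bsd-wall-cm-bed-w3 g8 (`--supports 19225`, helper). Companion of the lead's
`…InertBadAtThreeOddPrimeInstances` (p626343: the Manin conclusion needs only the ODD prime-modulus instances, conductor level).

WHAT THIS FILE DOES (memo `Cruxes/InertBadAtThree/EPSILON-RESOLVED-bsd-idea-18-g7.md` §1, display (T)): the stub speaks of a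
newform `f` of `V`, its periods `Ω^±_f`, the Birch–Manin twisted symbol sums `Σ_a χ(a){∞, a/m}_f` and binders `(ϖ, r)`; the CM road
(§§2–8 of the memo) computes `L(E_D, χ, 1)`. The two are joined here once and for all:

* `clause_even_of_LValue` / `clause_odd_of_LValue` — for ANY elliptic `V`, ANY level `N`, `f` with `IsNewformOf V f`, ANY prime
  `p`, a primitive `χ` mod `m` and the stub's binders `(ϖ, r)` (`ϖ·Ω^±(V) = Ω^±_f`,
  `∏_{ℓ∥N}(ℓ − a_ℓχ(ℓ))(ℓ − a_ℓχ(ℓ)⁻¹)·Σ_aχ(a){∞,a/m}_f = r·Ω^±_f(·i)`): the clause `∃ s, p ∤ s, s·ϖ·r ∈ ℤ̄` FOLLOWS from the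
  `f`-FREE statement «for SOME entire `L` with `L(s) = Σ χ̄(n) a_n(V) n⁻ˢ` (`re s > 2`): `∃ s, p ∤ s, s·τ(χ)·L(1)/Ω⁺(V) ∈ ℤ̄`»
  (resp. `/(i·Ω⁻(V))`). Mechanism (tree theorems only): Birch's formula `τ(χ)·L(f, χ̄, 1) = Σ_aχ(a){∞,a/m}_f`
  (`ModularForms.twisted_LValue_eq_holds`, valid for EVERY entire continuation), `a_n(f) = a_n(V)` (`IsNewformOf`), and the
  identity `ϖ·r = [∏_{ℓ∥N}(ℓ − a_ℓχ(ℓ))(ℓ − a_ℓχ̄(ℓ))]·τ(χ)·L(1)/Ω^±(V)` whose bracket is an algebraic integer.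
* `neronIntegralThreePolarAt_of_LValues` — the registered stub's body for ONE `V` (VERBATIM the text of
  `Lines/rubin_e1_inert_three.lean`'s `stub_neronIntegralThreeQuartic` after its `V`-binders, all levels `N`) from the `f`-free
  statement for every primitive `χ` of modulus `m` with `3 ∤ m` (the CM road proves more: no condition on `χ(3)` or `ord χ`).
* `neronIntegralThreeQuartic_of_LValues` — hence the whole registered stub from «for every globally minimal `V` with
  `j(V) = 1728` bad at `3`, every `m` with `3 ∤ m`, every primitive `χ` mod `m`: the two `f`-free integrality statements».
* `plainOdd_of_LValue` — the same service for the lead's announced v5 «plain odd» conductor-level clause (no Euler bracket: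
  `Σ_aχ(a){∞,a/ℓ}_f = r·Ω⁻_f·i`), any modulus.
* `not_three_dvd_c_of_oddLValues_of_hasCM` — composed with the lead's conductor-level lever
  `…InertBadAtThreeOddPrimeInstances.not_three_dvd_c_of_plainOddInstances_of_hasCM` (p626343): for a CM curve `W` with CM-inert bad `3`
  and a lattice-optimal `X₀(N_W)`-datum, `3 ∤ c` follows from the `f`-FREE statement «for every prime `ℓ ∤ N_W`, `ℓ ≡ 11 (12)`, every
  odd `χ` mod `ℓ` with `χ(3) ≠ 1`: `∃` entire `L` continuing `Σ χ̄(n)a_n(W)n⁻ˢ` and `s`, `3 ∤ s`, with `s·τ(χ)·L(1)/(i·Ω⁻(W)) ∈ ℤ̄`» —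
  the Manin input of crux `InertBadAtThree` now asks the CM side for `L`-VALUES ONLY.

HONEST FRAMING: nothing here proves any `L`-value integrality, any instance of F-es-18, Manin's conjecture, the crux, or BSD. No
definition, no named fact, no `sorry`; axioms standard. The `f`-free statements are the TARGET of the CM computation (Birch 1965 /
Rubin LNM 1716 Prop. 7.15 finite formula `GaussianLattice.thetaLFunction_one_eq_sum_kroneckerE₁` + smoothing + the μ₈-count at the inert `3`).
-/

set_option autoImplicit false
set_option linter.dupNamespace false

noncomputable section

open scoped BigOperators MatrixGroups ModularForm
open Complex CongruenceSubgroup WeierstrassCurve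
open Literature.NumberTheory.EllipticCurves Literature.NumberTheory.EllipticCurves.ModularForms
open Summit.BirchSwinnertonDyer.BirchSwinnertonDyer.Theorems.StarredOptimalManinUnitFiveSevenValueExit
  (isIntegral_gaussSum)

namespace Summit.BirchSwinnertonDyer.BirchSwinnertonDyer.Theorems.InertBadSignedBranchesInertBadAtThreeQuarticValueExit

/-! ## §1 Bookkeeping: the Euler bracket is an algebraic integer; the twisted series of `f` is that of `V` -/

section Bookkeeping

variable {N : ℕ} {m : ℕ} [NeZero m] (V : WeierstrassCurve ℚ)

/-- The symmetrised Euler bracket `∏_{ℓ∥N}(ℓ − a_ℓ(V)χ(ℓ))(ℓ − a_ℓ(V)χ(ℓ)⁻¹)` of F-es-18's body is an ALGEBRAIC INTEGER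
(`a_ℓ ∈ ℤ`, `χ(ℓ)` a root of unity or `0`, `χ(ℓ)⁻¹ = χ̄(ℓ)`). [folklore] -/
theorem isIntegral_eulerBracket (χ : DirichletCharacter ℂ m) :
    IsIntegral ℤ (∏ ℓ ∈ N.primeFactors with ¬ ℓ ^ 2 ∣ N,
        (((ℓ : ℂ) - (V.LFunction ℓ : ℂ) * χ (ℓ : ZMod m)) *
          ((ℓ : ℂ) - (V.LFunction ℓ : ℂ) * (χ (ℓ : ZMod m))⁻¹))) := by
  have hzint : ∀ z : ℤ, IsIntegral ℤ (z : ℂ) := fun z => by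
    simpa using isIntegral_algebraMap (R := ℤ) (A := ℂ) (x := z)
  have hnint : ∀ n : ℕ, IsIntegral ℤ (n : ℂ) := fun n => by
    simpa using isIntegral_algebraMap (R := ℤ) (A := ℂ) (x := (n : ℤ))
  refine IsIntegral.prod _ fun ℓ _ => ?_
  refine ((hnint ℓ).sub ((hzint _).mul (isIntegral_dirichletCharacter_apply χ _))).mul
    ((hnint ℓ).sub ((hzint _).mul ?_))
  rw [← MulChar.inv_apply_eq_inv']
  exact isIntegral_dirichletCharacter_apply χ⁻¹ _

variable [NeZero N] {f : CuspForm (Gamma0 N) 2}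

omit [NeZero m] in
/-- For the newform `f` of `V` the twisted series `L(f ⊗ χ, s) = Σ χ(n)a_n(f)n⁻ˢ` IS the series `Σ χ(n)a_n(V)n⁻ˢ` (`a_n(f) = a_n(V)`,
definitional half of `IsNewformOf`). [cite: BreuilConradDiamondTaylor2001, Thm. A] -/
theorem twistedLSeries_eq_of_isNewformOf (hf : IsNewformOf V f) (χ : DirichletCharacter ℂ m) (s : ℂ) :
    twistedLSeries f χ s = LSeries (fun n : ℕ ↦ χ (n : ZMod m) * (V.LFunction n : ℂ)) s := by
  unfold twistedLSeries
  congr 1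
  funext n
  rw [hf.2 n]

end Bookkeeping

/-! ## §2 The value exit, clause by clause (any level, any prime `p`) -/

section Exit

variable {N : ℕ} [NeZero N] {m : ℕ} [NeZero m] {p : ℕ}
  (V : WeierstrassCurve ℚ) [V.IsElliptic] {f : CuspForm (Gamma0 N) 2}

/-- ★ **Value exit, EVEN branch.** `f` the newform of `V` at ANY level `N`, `χ` primitive mod `m`, `ϖ ∈ ℚ`, `r ∈ ℂ` with
`ϖ·Ω⁺(V) = Ω⁺_f` and `∏_{ℓ∥N}(ℓ − a_ℓχ(ℓ))(ℓ − a_ℓχ(ℓ)⁻¹)·Σ_aχ(a){∞,a/m}_f = r·Ω⁺_f` (the stub's binders). If for SOME entire `L`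
with `L(s) = Σ χ̄(n)a_n(V)n⁻ˢ` on `re s > 2` one has `∃ s, p ∤ s, s·τ(χ)·L(1)/Ω⁺(V) ∈ ℤ̄`, then `∃ s, p ∤ s, s·ϖ·r ∈ ℤ̄`.
Identity: `ϖ·r = [Euler bracket]·τ(χ)·L(1)/Ω⁺(V)` (Birch's formula, valid for every entire continuation).
[cite: MazurTateTeitelbaum1986, §I.8 (8.6)] [cite: Kato2004Asterisque, Thm. 6.6 (1) (p. 163)] -/
theorem clause_even_of_LValue (hf : IsNewformOf V f) {χ : DirichletCharacter ℂ m} (hχ : χ.IsPrimitive)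
    (hint : ∃ L : ℂ → ℂ, Differentiable ℂ L ∧
      (∀ s : ℂ, 2 < s.re → L s = LSeries (fun n : ℕ ↦ χ⁻¹ (n : ZMod m) * (V.LFunction n : ℂ)) s) ∧
      ∃ s : ℕ, ¬ p ∣ s ∧ IsIntegral ℤ ((s : ℂ) *
        (gaussSum χ (ZMod.stdAddChar (N := m)) * L 1 / (V.realPeriodRat : ℂ))))
    {ϖ : ℚ} {r : ℂ} (hϖ : (ϖ : ℝ) * V.realPeriodRat = plusPeriod f)
    (hr : (∏ ℓ ∈ N.primeFactors with ¬ ℓ ^ 2 ∣ N,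
        (((ℓ : ℂ) - (V.LFunction ℓ : ℂ) * χ (ℓ : ZMod m)) *
          ((ℓ : ℂ) - (V.LFunction ℓ : ℂ) * (χ (ℓ : ZMod m))⁻¹))) *
        twistedSymbolSum f χ = r * (plusPeriod f : ℂ)) :
    ∃ s : ℕ, ¬ p ∣ s ∧ IsIntegral ℤ ((s : ℂ) * ϖ * r) := by
  obtain ⟨L, hLd, hLs, s, hps, hsint⟩ := hint
  refine ⟨s, hps, ?_⟩
  -- Birch's formula for `χ̄` and THIS continuation `L`
  have hLs' : ∀ z : ℂ, 2 < z.re → L z = twistedLSeries f χ⁻¹ z := fun z hz ↦ by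
    rw [hLs z hz, twistedLSeries_eq_of_isNewformOf V hf]
  have hBirch : gaussSum χ (ZMod.stdAddChar (N := m)) * L 1 = twistedSymbolSum f χ := by
    have h := twisted_LValue_eq_holds f (m := m) (isPrimitive_inv hχ) hLd hLs'
    rwa [inv_inv] at h
  set A : ℂ := ∏ ℓ ∈ N.primeFactors with ¬ ℓ ^ 2 ∣ N,
    (((ℓ : ℂ) - (V.LFunction ℓ : ℂ) * χ (ℓ : ZMod m)) * ((ℓ : ℂ) - (V.LFunction ℓ : ℂ) * (χ (ℓ : ZMod m))⁻¹)) with hA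
  have hAint : IsIntegral ℤ A := isIntegral_eulerBracket (N := N) V χ
  have hΩ0 : (V.realPeriodRat : ℂ) ≠ 0 := by
    exact_mod_cast (V.realPeriodRat_pos_holds : 0 < V.realPeriodRat).ne'
  by_cases hϖ0 : ϖ = 0
  · rw [hϖ0, Rat.cast_zero, mul_zero, zero_mul]; exact isIntegral_zero
  have hΩf : (plusPeriod f : ℂ) = (ϖ : ℂ) * (V.realPeriodRat : ℂ) := by
    rw [← hϖ, Complex.ofReal_mul, Complex.ofReal_ratCast]
  have key : (s : ℂ) * ϖ * r =
      A * ((s : ℂ) * (gaussSum χ (ZMod.stdAddChar (N := m)) * L 1 / (V.realPeriodRat : ℂ))) := by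
    have hϖc : (ϖ : ℂ) ≠ 0 := by exact_mod_cast hϖ0
    have hr' : r * ((ϖ : ℂ) * (V.realPeriodRat : ℂ)) = A * (gaussSum χ (ZMod.stdAddChar (N := m)) * L 1) := by
      rw [← hΩf, ← hr, hBirch]
    field_simp
    linear_combination (s : ℂ) * hr'
  rw [key]
  exact hAint.mul hsint

/-- ★ **Value exit, ODD branch.** Same with `ϖ·Ω⁻(V) = Ω⁻_f` (`Ω⁻(V) = V.imaginaryPeriodRat`), the defining identity
`∏…·Σ_aχ(a){∞,a/m}_f = r·Ω⁻_f·i`, and the value normalised by `i·Ω⁻(V)`: if for SOME entire `L` with `L(s) = Σ χ̄(n)a_n(V)n⁻ˢ`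
(`re s > 2`) `∃ s, p ∤ s, s·τ(χ)·L(1)/(i·Ω⁻(V)) ∈ ℤ̄`, then `∃ s, p ∤ s, s·ϖ·r ∈ ℤ̄`.
[cite: MazurTateTeitelbaum1986, §I.8 (8.6)] [cite: Kato2004Asterisque, Thm. 6.6 (1) (p. 163)] -/
theorem clause_odd_of_LValue (hf : IsNewformOf V f) {χ : DirichletCharacter ℂ m} (hχ : χ.IsPrimitive)
    (hint : ∃ L : ℂ → ℂ, Differentiable ℂ L ∧
      (∀ s : ℂ, 2 < s.re → L s = LSeries (fun n : ℕ ↦ χ⁻¹ (n : ZMod m) * (V.LFunction n : ℂ)) s) ∧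
      ∃ s : ℕ, ¬ p ∣ s ∧ IsIntegral ℤ ((s : ℂ) *
        (gaussSum χ (ZMod.stdAddChar (N := m)) * L 1 / (Complex.I * (V.imaginaryPeriodRat : ℂ)))))
    {ϖ : ℚ} {r : ℂ} (hϖ : (ϖ : ℝ) * V.imaginaryPeriodRat = minusPeriod f)
    (hr : (∏ ℓ ∈ N.primeFactors with ¬ ℓ ^ 2 ∣ N,
        (((ℓ : ℂ) - (V.LFunction ℓ : ℂ) * χ (ℓ : ZMod m)) *
          ((ℓ : ℂ) - (V.LFunction ℓ : ℂ) * (χ (ℓ : ZMod m))⁻¹))) *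
        twistedSymbolSum f χ = r * (minusPeriod f : ℂ) * Complex.I) :
    ∃ s : ℕ, ¬ p ∣ s ∧ IsIntegral ℤ ((s : ℂ) * ϖ * r) := by
  obtain ⟨L, hLd, hLs, s, hps, hsint⟩ := hint
  refine ⟨s, hps, ?_⟩
  have hLs' : ∀ z : ℂ, 2 < z.re → L z = twistedLSeries f χ⁻¹ z := fun z hz ↦ by
    rw [hLs z hz, twistedLSeries_eq_of_isNewformOf V hf]
  have hBirch : gaussSum χ (ZMod.stdAddChar (N := m)) * L 1 = twistedSymbolSum f χ := by
    have h := twisted_LValue_eq_holds f (m := m) (isPrimitive_inv hχ) hLd hLs'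
    rwa [inv_inv] at h
  set A : ℂ := ∏ ℓ ∈ N.primeFactors with ¬ ℓ ^ 2 ∣ N,
    (((ℓ : ℂ) - (V.LFunction ℓ : ℂ) * χ (ℓ : ZMod m)) * ((ℓ : ℂ) - (V.LFunction ℓ : ℂ) * (χ (ℓ : ZMod m))⁻¹)) with hA
  have hAint : IsIntegral ℤ A := isIntegral_eulerBracket (N := N) V χ
  have hΩ0 : (V.imaginaryPeriodRat : ℂ) ≠ 0 := by
    exact_mod_cast (V.imaginaryPeriodRat_pos).ne'
  by_cases hϖ0 : ϖ = 0
  · rw [hϖ0, Rat.cast_zero, mul_zero, zero_mul]; exact isIntegral_zero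
  have hΩf : (minusPeriod f : ℂ) = (ϖ : ℂ) * (V.imaginaryPeriodRat : ℂ) := by
    rw [← hϖ, Complex.ofReal_mul, Complex.ofReal_ratCast]
  have key : (s : ℂ) * ϖ * r =
      A * ((s : ℂ) * (gaussSum χ (ZMod.stdAddChar (N := m)) * L 1 / (Complex.I * (V.imaginaryPeriodRat : ℂ)))) := by
    have hϖc : (ϖ : ℂ) ≠ 0 := by exact_mod_cast hϖ0
    have hr' : r * ((ϖ : ℂ) * (V.imaginaryPeriodRat : ℂ)) * Complex.I =
        A * (gaussSum χ (ZMod.stdAddChar (N := m)) * L 1) := by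
      rw [← hΩf, ← hr, hBirch]
    field_simp
    linear_combination (s : ℂ) * hr'
  rw [key]
  exact hAint.mul hsint

/-- ★ **Value exit for the lead's v5 «plain odd» clause** (no Euler bracket: `Σ_aχ(a){∞,a/m}_f = r·Ω⁻_f·i`), any level and
modulus: `∃ s, p ∤ s, s·ϖ·r ∈ ℤ̄` follows from the `f`-free `∃ s, p ∤ s, s·τ(χ)·L(1)/(i·Ω⁻(V)) ∈ ℤ̄` for some entire
continuation `L` of `Σ χ̄(n)a_n(V)n⁻ˢ`. Identity: `ϖ·r = τ(χ)·L(1)/(i·Ω⁻(V))`. [cite: MazurTateTeitelbaum1986, §I.8 (8.6)] -/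
theorem plainOdd_of_LValue (hf : IsNewformOf V f) {χ : DirichletCharacter ℂ m} (hχ : χ.IsPrimitive)
    (hint : ∃ L : ℂ → ℂ, Differentiable ℂ L ∧
      (∀ s : ℂ, 2 < s.re → L s = LSeries (fun n : ℕ ↦ χ⁻¹ (n : ZMod m) * (V.LFunction n : ℂ)) s) ∧
      ∃ s : ℕ, ¬ p ∣ s ∧ IsIntegral ℤ ((s : ℂ) *
        (gaussSum χ (ZMod.stdAddChar (N := m)) * L 1 / (Complex.I * (V.imaginaryPeriodRat : ℂ)))))
    {ϖ : ℚ} {r : ℂ} (hϖ : (ϖ : ℝ) * V.imaginaryPeriodRat = minusPeriod f)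
    (hr : twistedSymbolSum f χ = r * (minusPeriod f : ℂ) * Complex.I) :
    ∃ s : ℕ, ¬ p ∣ s ∧ IsIntegral ℤ ((s : ℂ) * ϖ * r) := by
  obtain ⟨L, hLd, hLs, s, hps, hsint⟩ := hint
  refine ⟨s, hps, ?_⟩
  have hLs' : ∀ z : ℂ, 2 < z.re → L z = twistedLSeries f χ⁻¹ z := fun z hz ↦ by
    rw [hLs z hz, twistedLSeries_eq_of_isNewformOf V hf]
  have hBirch : gaussSum χ (ZMod.stdAddChar (N := m)) * L 1 = twistedSymbolSum f χ := by
    have h := twisted_LValue_eq_holds f (m := m) (isPrimitive_inv hχ) hLd hLs'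
    rwa [inv_inv] at h
  have hΩ0 : (V.imaginaryPeriodRat : ℂ) ≠ 0 := by
    exact_mod_cast (V.imaginaryPeriodRat_pos).ne'
  by_cases hϖ0 : ϖ = 0
  · rw [hϖ0, Rat.cast_zero, mul_zero, zero_mul]; exact isIntegral_zero
  have hΩf : (minusPeriod f : ℂ) = (ϖ : ℂ) * (V.imaginaryPeriodRat : ℂ) := by
    rw [← hϖ, Complex.ofReal_mul, Complex.ofReal_ratCast]
  have key : (s : ℂ) * ϖ * r =
      (s : ℂ) * (gaussSum χ (ZMod.stdAddChar (N := m)) * L 1 / (Complex.I * (V.imaginaryPeriodRat : ℂ))) := by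
    have hϖc : (ϖ : ℂ) ≠ 0 := by exact_mod_cast hϖ0
    have hr' : r * ((ϖ : ℂ) * (V.imaginaryPeriodRat : ℂ)) * Complex.I =
        gaussSum χ (ZMod.stdAddChar (N := m)) * L 1 := by
      rw [← hΩf, ← hr, hBirch]
    field_simp
    linear_combination (s : ℂ) * hr'
  rw [key]
  exact hsint

end Exit

/-! ## §3 The registered stub's body for one curve, and the whole stub, from the `f`-free values -/

section Stub

/-- ★ **The body of `stub_neronIntegralThreeQuartic` for ONE curve `V` (VERBATIM the registered text after the `V`-binders: every
level `N`, every newform `f` of `V`, both parities) from the `f`-FREE Néron `3`-integrality of the twisted critical values**: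
for every modulus `m` with `3 ∤ m` and every primitive `χ` mod `m` (granted the stub's own side conditions `χ ≠ 1`, `3 ∤ ord χ`,
`χ(3) ∉ {1, −1}` as extra hypotheses the CM road may ignore), SOME entire continuation `L` of `Σ χ̄(n)a_n(V)n⁻ˢ` has
`s·τ(χ)·L(1)/Ω⁺(V) ∈ ℤ̄` (`χ` even) / `s·τ(χ)·L(1)/(i·Ω⁻(V)) ∈ ℤ̄` (`χ` odd) for some `3 ∤ s`. (The level `N` disappears:
`(m, 3N) = 1 ⇒ 3 ∤ m`; the reduction-type and irreducibility binders of the body are not needed.)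
[cite: Kato2004Asterisque, (8.1.3) (p. 180), Thm. 6.6 (1) (p. 163)] [cite: MazurTateTeitelbaum1986, §I.8 (8.6)] -/
theorem neronIntegralThreePolarAt_of_LValues (V : WeierstrassCurve ℚ) [V.IsElliptic] [V.IsGloballyMinimal]
    (hEven : ∀ (m : ℕ) [NeZero m], ¬ 3 ∣ m → ∀ χ : DirichletCharacter ℂ m, χ.IsPrimitive → χ ≠ 1 → ¬ 3 ∣ orderOf χ →
      χ (3 : ZMod m) ≠ 1 → χ (3 : ZMod m) ≠ -1 → χ.Even →
      ∃ L : ℂ → ℂ, Differentiable ℂ L ∧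
        (∀ s : ℂ, 2 < s.re → L s = LSeries (fun n : ℕ ↦ χ⁻¹ (n : ZMod m) * (V.LFunction n : ℂ)) s) ∧
        ∃ s : ℕ, ¬ 3 ∣ s ∧ IsIntegral ℤ ((s : ℂ) *
          (gaussSum χ (ZMod.stdAddChar (N := m)) * L 1 / (V.realPeriodRat : ℂ))))
    (hOdd : ∀ (m : ℕ) [NeZero m], ¬ 3 ∣ m → ∀ χ : DirichletCharacter ℂ m, χ.IsPrimitive → χ ≠ 1 → ¬ 3 ∣ orderOf χ →
      χ (3 : ZMod m) ≠ 1 → χ (3 : ZMod m) ≠ -1 → χ.Odd →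
      ∃ L : ℂ → ℂ, Differentiable ℂ L ∧
        (∀ s : ℂ, 2 < s.re → L s = LSeries (fun n : ℕ ↦ χ⁻¹ (n : ZMod m) * (V.LFunction n : ℂ)) s) ∧
        ∃ s : ℕ, ¬ 3 ∣ s ∧ IsIntegral ℤ ((s : ℂ) *
          (gaussSum χ (ZMod.stdAddChar (N := m)) * L 1 / (Complex.I * (V.imaginaryPeriodRat : ℂ))))) :
    ∀ {N : ℕ} [NeZero N]
      (f : CuspForm (CongruenceSubgroup.Gamma0 N) 2)
      (_ : Literature.NumberTheory.EllipticCurves.ModularForms.IsNewformOf V f)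
      (_ : ¬ V.HasGoodReductionAtPrime 3) (_ : ¬ V.HasMultiplicativeReductionAtPrime 3)
      (_ : V.HasIrreducibleModPGaloisRep 3) (m : ℕ) [NeZero m] (_ : m.Coprime (3 * N))
      (χ : DirichletCharacter ℂ m) (_ : χ.IsPrimitive) (_ : χ ≠ 1) (_ : ¬ 3 ∣ orderOf χ)
      (_ : χ (3 : ZMod m) ≠ 1) (_ : χ (3 : ZMod m) ≠ -1) (ϖ : ℚ) (r : ℂ),
      (χ.Even → (ϖ : ℝ) * V.realPeriodRat = Literature.NumberTheory.EllipticCurves.ModularForms.plusPeriod f →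
        (∏ ℓ ∈ N.primeFactors with ¬ ℓ ^ 2 ∣ N,
            (((ℓ : ℂ) - (V.LFunction ℓ : ℂ) * χ (ℓ : ZMod m)) *
              ((ℓ : ℂ) - (V.LFunction ℓ : ℂ) * (χ (ℓ : ZMod m))⁻¹))) *
            Literature.NumberTheory.EllipticCurves.ModularForms.twistedSymbolSum f χ =
          r * (Literature.NumberTheory.EllipticCurves.ModularForms.plusPeriod f : ℂ) →
        ∃ s : ℕ, ¬ 3 ∣ s ∧ IsIntegral ℤ ((s : ℂ) * ϖ * r)) ∧
      (χ.Odd → (ϖ : ℝ) * V.imaginaryPeriodRat = Literature.NumberTheory.EllipticCurves.ModularForms.minusPeriod f →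
        (∏ ℓ ∈ N.primeFactors with ¬ ℓ ^ 2 ∣ N,
            (((ℓ : ℂ) - (V.LFunction ℓ : ℂ) * χ (ℓ : ZMod m)) *
              ((ℓ : ℂ) - (V.LFunction ℓ : ℂ) * (χ (ℓ : ZMod m))⁻¹))) *
            Literature.NumberTheory.EllipticCurves.ModularForms.twistedSymbolSum f χ =
          r * (Literature.NumberTheory.EllipticCurves.ModularForms.minusPeriod f : ℂ) * Complex.I →
        ∃ s : ℕ, ¬ 3 ∣ s ∧ IsIntegral ℤ ((s : ℂ) * ϖ * r)) := by
  intro N _ f hf _ _ _ m _ hm χ hχ h1 hord h3 h3' ϖ r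
  have h3m : ¬ 3 ∣ m := by
    intro h
    have h' : 3 ∣ Nat.gcd m (3 * N) := Nat.dvd_gcd h (dvd_mul_right 3 N)
    rw [hm] at h'
    exact absurd (Nat.le_of_dvd Nat.one_pos h') (by norm_num)
  exact ⟨fun hev hϖ hr ↦ clause_even_of_LValue V hf hχ (hEven m h3m χ hχ h1 hord h3 h3' hev) hϖ hr,
    fun hod hϖ hr ↦ clause_odd_of_LValue V hf hχ (hOdd m h3m χ hχ h1 hord h3 h3' hod) hϖ hr⟩

/-- ★ **The whole registered stub `stub_neronIntegralThreeQuartic` (its statement VERBATIM) from the `f`-free twisted-value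
integrality on the quartic cell**: for every globally minimal `V` with `j(V) = 1728` bad at `3`, every `m` with `3 ∤ m` and every
primitive `χ` mod `m` (with the stub's side conditions available as hypotheses), the even/odd Néron `3`-integrality of
`τ(χ)·L(V, χ̄, 1)` for some entire continuation. This is the TRANSFER TARGET of line `rubin_e1_inert_three` in `L`-value form
(memo EPSILON-RESOLVED §1 (T)); the CM road (§§2–8) is to discharge the two hypotheses.
[cite: Kato2004Asterisque, (8.1.3) (p. 180)] [cite: Rubin1999, Prop. 7.15] -/
theorem neronIntegralThreeQuartic_of_LValues
    (hEven : ∀ (V : WeierstrassCurve ℚ) [V.IsElliptic] [V.IsGloballyMinimal], V.j = 1728 → ¬ V.HasGoodReductionAtPrime 3 →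
      ∀ (m : ℕ) [NeZero m], ¬ 3 ∣ m → ∀ χ : DirichletCharacter ℂ m, χ.IsPrimitive → χ ≠ 1 → ¬ 3 ∣ orderOf χ →
      χ (3 : ZMod m) ≠ 1 → χ (3 : ZMod m) ≠ -1 → χ.Even →
      ∃ L : ℂ → ℂ, Differentiable ℂ L ∧
        (∀ s : ℂ, 2 < s.re → L s = LSeries (fun n : ℕ ↦ χ⁻¹ (n : ZMod m) * (V.LFunction n : ℂ)) s) ∧
        ∃ s : ℕ, ¬ 3 ∣ s ∧ IsIntegral ℤ ((s : ℂ) *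
          (gaussSum χ (ZMod.stdAddChar (N := m)) * L 1 / (V.realPeriodRat : ℂ))))
    (hOdd : ∀ (V : WeierstrassCurve ℚ) [V.IsElliptic] [V.IsGloballyMinimal], V.j = 1728 → ¬ V.HasGoodReductionAtPrime 3 →
      ∀ (m : ℕ) [NeZero m], ¬ 3 ∣ m → ∀ χ : DirichletCharacter ℂ m, χ.IsPrimitive → χ ≠ 1 → ¬ 3 ∣ orderOf χ →
      χ (3 : ZMod m) ≠ 1 → χ (3 : ZMod m) ≠ -1 → χ.Odd →
      ∃ L : ℂ → ℂ, Differentiable ℂ L ∧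
        (∀ s : ℂ, 2 < s.re → L s = LSeries (fun n : ℕ ↦ χ⁻¹ (n : ZMod m) * (V.LFunction n : ℂ)) s) ∧
        ∃ s : ℕ, ¬ 3 ∣ s ∧ IsIntegral ℤ ((s : ℂ) *
          (gaussSum χ (ZMod.stdAddChar (N := m)) * L 1 / (Complex.I * (V.imaginaryPeriodRat : ℂ))))) :
    ∀ (V : WeierstrassCurve ℚ) [V.IsElliptic] [V.IsGloballyMinimal],
      V.j = 1728 → ¬ V.HasGoodReductionAtPrime 3 →
      ∀ {N : ℕ} [NeZero N]
        (f : CuspForm (CongruenceSubgroup.Gamma0 N) 2)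
        (_ : Literature.NumberTheory.EllipticCurves.ModularForms.IsNewformOf V f)
        (_ : ¬ V.HasGoodReductionAtPrime 3) (_ : ¬ V.HasMultiplicativeReductionAtPrime 3)
        (_ : V.HasIrreducibleModPGaloisRep 3) (m : ℕ) [NeZero m] (_ : m.Coprime (3 * N))
        (χ : DirichletCharacter ℂ m) (_ : χ.IsPrimitive) (_ : χ ≠ 1) (_ : ¬ 3 ∣ orderOf χ)
        (_ : χ (3 : ZMod m) ≠ 1) (_ : χ (3 : ZMod m) ≠ -1) (ϖ : ℚ) (r : ℂ),
        (χ.Even → (ϖ : ℝ) * V.realPeriodRat = Literature.NumberTheory.EllipticCurves.ModularForms.plusPeriod f →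
          (∏ ℓ ∈ N.primeFactors with ¬ ℓ ^ 2 ∣ N,
              (((ℓ : ℂ) - (V.LFunction ℓ : ℂ) * χ (ℓ : ZMod m)) *
                ((ℓ : ℂ) - (V.LFunction ℓ : ℂ) * (χ (ℓ : ZMod m))⁻¹))) *
              Literature.NumberTheory.EllipticCurves.ModularForms.twistedSymbolSum f χ =
            r * (Literature.NumberTheory.EllipticCurves.ModularForms.plusPeriod f : ℂ) →
          ∃ s : ℕ, ¬ 3 ∣ s ∧ IsIntegral ℤ ((s : ℂ) * ϖ * r)) ∧
        (χ.Odd → (ϖ : ℝ) * V.imaginaryPeriodRat = Literature.NumberTheory.EllipticCurves.ModularForms.minusPeriod f →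
          (∏ ℓ ∈ N.primeFactors with ¬ ℓ ^ 2 ∣ N,
              (((ℓ : ℂ) - (V.LFunction ℓ : ℂ) * χ (ℓ : ZMod m)) *
                ((ℓ : ℂ) - (V.LFunction ℓ : ℂ) * (χ (ℓ : ZMod m))⁻¹))) *
              Literature.NumberTheory.EllipticCurves.ModularForms.twistedSymbolSum f χ =
            r * (Literature.NumberTheory.EllipticCurves.ModularForms.minusPeriod f : ℂ) * Complex.I →
          ∃ s : ℕ, ¬ 3 ∣ s ∧ IsIntegral ℤ ((s : ℂ) * ϖ * r)) :=
  fun V _ _ hj hbad ↦ neronIntegralThreePolarAt_of_LValues V (hEven V hj hbad) (hOdd V hj hbad)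

end Stub

/-! ## §4 Composition with the lead's conductor-level lever: the Manin input asks for `L`-values only -/

section Manin

open Literature.NumberTheory.EllipticCurves.Rank1Residual
open Summit.BirchSwinnertonDyer.BirchSwinnertonDyer.Theorems.ManinLocalTwoThree (isPrimitive_of_odd)
open Summit.BirchSwinnertonDyer.BirchSwinnertonDyer.Theorems.InertBadSignedBranchesInertBadAtThreeOddPrimeInstances
  (not_three_dvd_c_of_plainOddInstances_of_hasCM)

/-- ★ **`3 ∤ c` for a CM curve with CM-inert bad `3` from `f`-FREE odd twisted `L`-values.** For `W` with CM, `3` inert in the CM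
field and bad, and a lattice-optimal conductor-level `X₀(N_W)`-datum `D`: if for every prime `ℓ ∤ N_W` with `ℓ ≡ 11 (mod 12)` and every
odd `χ` mod `ℓ` with `χ(3) ≠ 1` SOME entire continuation `L` of `Σ χ̄(n)a_n(W)n⁻ˢ` satisfies `s·τ(χ)·L(1)/(i·Ω⁻(W)) ∈ ℤ̄` for some
`3 ∤ s`, then `3 ∤ c(D)`. (Lead's lever p626343 + `plainOdd_of_LValue`; odd characters of prime modulus are primitive.)
[cite: Kato2004Asterisque, Thm. 9.7 (p. 189)] [cite: Mazur1978, §6 Prop. 6.3 (1) (p. 153)] [cite: MazurTateTeitelbaum1986, §I.8 (8.6)] -/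
theorem not_three_dvd_c_of_oddLValues_of_hasCM
    (W : WeierstrassCurve ℚ) [W.IsElliptic] [NeZero (W.conductorNorm ℤ)]
    (D : ModularParametrizationData W (W.conductorNorm ℤ))
    (hopt : ∀ z ∈ D.L.lattice, ∃ w ∈ periodLattice D.f, z = D.c * w)
    (hCM : W.HasCM) (hin : CMInert W 3) (hbad : ¬ Good W 3)
    (hL : ∀ (ℓ : ℕ) [NeZero ℓ], ℓ.Prime → ¬ ℓ ∣ W.conductorNorm ℤ → ℓ % 12 = 11 →
      ∀ χ : DirichletCharacter ℂ ℓ, χ.Odd → χ (3 : ZMod ℓ) ≠ 1 →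
        ∃ L : ℂ → ℂ, Differentiable ℂ L ∧
          (∀ s : ℂ, 2 < s.re → L s = LSeries (fun n : ℕ ↦ χ⁻¹ (n : ZMod ℓ) * (W.LFunction n : ℂ)) s) ∧
          ∃ s : ℕ, ¬ 3 ∣ s ∧ IsIntegral ℤ ((s : ℂ) *
            (gaussSum χ (ZMod.stdAddChar (N := ℓ)) * L 1 / (Complex.I * (W.imaginaryPeriodRat : ℂ))))) :
    ¬ (3 : ℤ) ∣ D.c := by
  refine not_three_dvd_c_of_plainOddInstances_of_hasCM W D hopt hCM hin hbad ?_
  intro ℓ _ hℓ hℓN h12 χ hχ hχ3 ϖ r hϖ hval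
  haveI : Fact ℓ.Prime := ⟨hℓ⟩
  exact plainOdd_of_LValue W D.isNewformOf (isPrimitive_of_odd hχ) (hL ℓ hℓ hℓN h12 χ hχ hχ3) hϖ hval

end Manin

end Summit.BirchSwinnertonDyer.BirchSwinnertonDyer.Theorems.InertBadSignedBranchesInertBadAtThreeQuarticValueExit

end
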